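import Literature.Analysis.ValidatedNumerics.MatrixEigenEnclosure

/-!
# Rayleigh-quotient lower bound for the compressive strain `−λ_min`

Reproduction of the one analytic step of a *lower* bound on the largest compressive principal
strain by sampling: for a real symmetric matrix `S` (the strain tensor at one point) and ANY
non-zero test vector `e`, the Rayleigh quotient `r = (eᵀ S e)/(eᵀ e)` satisfies `λ_min(S) ≤ r`,
hence `−λ_min(S) ≥ −r`; the choice of `e` (in practice a floating-point eigenvector converted
exactly to rationals) affects only tightness, never rigour. Used by the certified lower bounds
of `g⁻ = sup_x (−λ_min S(x))` for explicit finite objects (two-engine ball arithmetic).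

The Hermitian core is `exists_eigenvalues_le_of_re_form_le` (same topic); this file states the
real, quotient-form corollaries a certificate quotes. [folklore; Rayleigh–Ritz, e.g. Horn–Johnson
2013, Thm 4.2.2]
-/

open Finset Matrix

namespace Literature.Analysis.ValidatedNumerics

variable {m : Type*} [Fintype m] [DecidableEq m] {S : Matrix m m ℝ}

/-- For a real symmetric `S` and `e ≠ 0` (as `Σ eᵢ² > 0`), some eigenvalue of `S` is at most the
Rayleigh quotient `(e ⬝ S e) / (e ⬝ e)`. [folklore] -/
theorem exists_eigenvalues_le_rayleigh (hS : S.IsHermitian) {e : m → ℝ}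
    (he : 0 < ∑ i, e i ^ 2) :
    ∃ i, hS.eigenvalues i ≤ (e ⬝ᵥ (S *ᵥ e)) / ∑ i, e i ^ 2 := by
  have he' : 0 < ∑ i, ‖e i‖ ^ 2 := by simpa [Real.norm_eq_abs, sq_abs] using he
  refine exists_eigenvalues_le_of_re_form_le hS he' ?_
  have hsum : ∑ i, ‖e i‖ ^ 2 = ∑ i, e i ^ 2 := by simp [Real.norm_eq_abs, sq_abs]
  rw [hsum]
  have : RCLike.re (star e ⬝ᵥ (S *ᵥ e)) = e ⬝ᵥ (S *ᵥ e) := by simp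
  rw [this, div_mul_cancel₀ _ he.ne']

/-- **Compressive-strain lower bound.** With `Nonempty m`, the largest compressive principal strain
`sup_i (−λᵢ(S))` is at least `−(e ⬝ S e)/(e ⬝ e)` for every `e ≠ 0`. This is exactly the step
that turns a ball-arithmetic evaluation of one Rayleigh quotient into a certified lower bound on
`−λ_min`. [folklore] -/
theorem neg_rayleigh_le_sup'_neg_eigenvalues [Nonempty m] (hS : S.IsHermitian) {e : m → ℝ}
    (he : 0 < ∑ i, e i ^ 2) :
    -((e ⬝ᵥ (S *ᵥ e)) / ∑ i, e i ^ 2) ≤ univ.sup' univ_nonempty (fun i => -hS.eigenvalues i) := by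
  obtain ⟨i, hi⟩ := exists_eigenvalues_le_rayleigh hS he
  exact le_trans (neg_le_neg hi) (le_sup' (fun i => -hS.eigenvalues i) (mem_univ i))

/-- Pointwise-to-sup version: one point `x₀` and one test vector give a lower bound for
`g⁻ = sup_x (−λ_min S(x))` whenever that supremum is bounded above (as it is for a continuous
field on a compact set, or for the explicit finite objects of a certificate). [folklore] -/
theorem neg_rayleigh_le_ciSup [Nonempty m] {X : Type*} [Nonempty X] {S : X → Matrix m m ℝ}
    (hS : ∀ x, (S x).IsHermitian)
    (hbdd : BddAbove (Set.range fun x => univ.sup' univ_nonempty (fun i => -(hS x).eigenvalues i)))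
    (x₀ : X) {e : m → ℝ} (he : 0 < ∑ i, e i ^ 2) :
    -((e ⬝ᵥ (S x₀ *ᵥ e)) / ∑ i, e i ^ 2) ≤
      ⨆ x, univ.sup' univ_nonempty (fun i => -(hS x).eigenvalues i) :=
  le_trans (neg_rayleigh_le_sup'_neg_eigenvalues (hS x₀) he) (le_ciSup hbdd x₀)

end Literature.Analysis.ValidatedNumerics
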